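import Literature.AlgebraicGeometry.Resolution.CanonicalResolutionSmoothCentre
import HarnessLib

/-!
# Regularity of a closed subscheme read on the quotient stalks `𝒪_{X,x} / C_x`

Topic: `Literature/AlgebraicGeometry/Resolution`. For a locally Noetherian scheme `X` and a
(quasi-coherent) ideal sheaf `C` with closed subscheme `V(C)` (Mathlib's
`IdealSheafData.subscheme`), the local rings of `V(C)` are the quotients `𝒪_{X,x} / C_x` of the
local rings of `X` by the stalks of `C` (`stalkIdeal`, `MarkedIdeals.lean`) at the points
`x ∈ V(C)`. `CanonicalResolutionSmoothCentre.lean` proves one half of the resulting criterion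
(`isRegularLocalRing_stalk_quotient_stalkIdeal`: `V(C)` regular ⇒ every `𝒪_{X,x} / C_x`
regular); this file PROVES the other half and records the criterion:

* `Scheme.isRegular_subscheme_of_forall` — if `𝒪_{X,x} / C_x` is a regular local ring for
  every `x ∈ V(C)`, then `V(C)` is a regular scheme (on the affine chart
  `Spec Γ(X, U)/C(U)` of `V(C)` over an affine open `U`, the localisation at a prime `𝔭/C(U)`
  is `Γ(X, U)_𝔭 / C(U) Γ(X, U)_𝔭 = 𝒪_{X,x} / C_x` for the point `x` of `𝔭`);
* `Scheme.isRegular_subscheme_iff`.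

(Used to localise the regularity clause "`Ẽ'` is nonsingular" of de Jong 1996, 4.27 to the
points over the centre of the blow-up.) All statements are [folklore].
-/

noncomputable section

open CategoryTheory CategoryTheory.Limits AlgebraicGeometry TopologicalSpace Topology IsLocalRing

namespace Literature.AlgebraicGeometry.Resolution

universe u

/-- **Localisation of a quotient at a prime is the quotient of the localisation**: for an ideal
`I ⊆ A` and a prime `P` of `A/I` with preimage `𝔭 ⊇ I`, `(A/I)_P ≅ A_𝔭 / I A_𝔭`; hence
`(A/I)_P` is a regular local ring as soon as `A_𝔭 / I A_𝔭` is. [folklore] -/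
theorem isRegularLocalRing_localization_atPrime_quotient {A : Type u} [CommRing A] (I : Ideal A)
    (P : Ideal (A ⧸ I)) [P.IsPrime]
    (h : IsRegularLocalRing (Localization.AtPrime (P.comap (Ideal.Quotient.mk I)) ⧸
      I.map (algebraMap A (Localization.AtPrime (P.comap (Ideal.Quotient.mk I)))))) :
    IsRegularLocalRing (Localization.AtPrime P) := by
  set p : Ideal A := P.comap (Ideal.Quotient.mk I) with hp
  have hmem : ∀ c : A, Ideal.Quotient.mk I c ∈ P ↔ c ∈ p := fun c => by
    rw [hp, Ideal.mem_comap]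
  have hM : Algebra.algebraMapSubmonoid (A ⧸ I) p.primeCompl = P.primeCompl := by
    ext b
    constructor
    · rintro ⟨c, hc, rfl⟩
      exact fun h => hc ((hmem c).mp h)
    · intro hb
      obtain ⟨c, rfl⟩ := Ideal.Quotient.mk_surjective b
      exact ⟨c, fun h => hb ((hmem c).mpr h), rfl⟩
  haveI : IsLocalization.AtPrime
      (Localization.AtPrime p ⧸ I.map (algebraMap A (Localization.AtPrime p))) P := by
    have := (inferInstance : IsLocalization (Algebra.algebraMapSubmonoid (A ⧸ I) p.primeCompl)
      (Localization.AtPrime p ⧸ I.map (algebraMap A (Localization.AtPrime p))))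
    rwa [hM] at this
  haveI := h
  exact IsRegularLocalRing.of_ringEquiv (IsLocalization.algEquiv P.primeCompl
    (Localization.AtPrime p ⧸ I.map (algebraMap A (Localization.AtPrime p)))
    (Localization.AtPrime P)).toRingEquiv

/-- **A closed subscheme whose quotient stalks `𝒪_{X,x} / C_x` are regular is regular**: for
`X` locally Noetherian and an ideal sheaf `C`, if `𝒪_{X,x} / C_x` is a regular local ring for
every `x ∈ V(C)`, then the closed subscheme `V(C)` is a regular scheme. [folklore] -/
theorem Scheme.isRegular_subscheme_of_forall {X : Scheme.{u}} [IsLocallyNoetherian X]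
    (C : X.IdealSheafData)
    (h : ∀ x ∈ C.support, IsRegularLocalRing (X.presheaf.stalk x ⧸ stalkIdeal C x)) :
    Scheme.IsRegular C.subscheme := by
  refine Scheme.IsRegular.of_forall_exists_isOpenImmersion fun c => ?_
  obtain ⟨y, hy⟩ := C.subschemeCover.covers c
  refine ⟨_, C.subschemeCover.f (C.subschemeCover.idx c), inferInstance, ⟨y, hy⟩, ?_⟩
  -- the chart over the affine open `U` is `Spec (Γ(X, U) / C(U))`
  generalize C.subschemeCover.idx c = U
  obtain ⟨U, hU⟩ := U
  haveI : IsNoetherianRing Γ(X, U) := IsLocallyNoetherian.component_noetherian ⟨U, hU⟩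
  set I : Ideal Γ(X, U) := C.ideal ⟨U, hU⟩ with hI
  change Scheme.IsRegular (Spec (.of (Γ(X, U) ⧸ I)))
  rw [Scheme.isRegular_Spec_iff]
  refine isRegularRing_iff.mpr fun P hP => ?_
  haveI := hP
  -- the prime `𝔭 ⊇ C(U)` of `Γ(X, U)` under `P`, and its point `x ∈ U ∩ V(C)`
  let p : PrimeSpectrum Γ(X, U) := ⟨P.comap (Ideal.Quotient.mk I), Ideal.comap_isPrime _ _⟩
  have hIp : I ≤ p.asIdeal := fun a ha => by
    change Ideal.Quotient.mk I a ∈ P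
    rw [Ideal.Quotient.eq_zero_iff_mem.mpr ha]
    exact P.zero_mem
  let x : X := hU.fromSpec p
  have hxU : x ∈ U := hU.range_fromSpec.le ⟨p, rfl⟩
  have hx : x ∈ C.support := by
    rw [Scheme.IdealSheafData.mem_support_iff_of_mem (I := C) (U := ⟨U, hU⟩) hxU,
      Scheme.mem_zeroLocus_iff]
    intro f hf
    have hmem : x ∈ X.basicOpen f ↔ f ∉ p.asIdeal := by
      rw [← PrimeSpectrum.mem_basicOpen, ← hU.fromSpec_preimage_basicOpen f]
      rfl
    exact fun hxf => (hmem.mp hxf) (hIp hf)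
  -- `𝒪_{X,x} / C_x ≅ Γ(X, U)_𝔭 / C(U) Γ(X, U)_𝔭`
  haveI hreg := h x hx
  letI : Algebra Γ(X, U) (X.presheaf.stalk x) :=
    TopCat.Presheaf.algebra_section_stalk X.presheaf ⟨x, hxU⟩
  haveI : IsLocalization.AtPrime (X.presheaf.stalk x) p.asIdeal := hU.isLocalization_stalk' p hxU
  let e : Localization.AtPrime p.asIdeal ≃ₐ[Γ(X, U)] X.presheaf.stalk x :=
    IsLocalization.algEquiv p.asIdeal.primeCompl _ _
  have hst : stalkIdeal C x = I.map (algebraMap Γ(X, U) (X.presheaf.stalk x)) :=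
    stalkIdeal_eq_map_germ C ⟨U, hU⟩ hxU
  have hmap : stalkIdeal C x =
      (I.map (algebraMap Γ(X, U) (Localization.AtPrime p.asIdeal))).map (e : _ →+* _) := by
    rw [hst, Ideal.map_map]
    congr 1
    exact (e.toAlgHom.comp_algebraMap).symm
  have hq : IsRegularLocalRing (Localization.AtPrime p.asIdeal ⧸
      I.map (algebraMap Γ(X, U) (Localization.AtPrime p.asIdeal))) :=
    IsRegularLocalRing.of_ringEquiv (Ideal.quotientEquiv _ _ e.toRingEquiv hmap).symm
  exact isRegularLocalRing_localization_atPrime_quotient I P hq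

/-- **Regularity of a closed subscheme on the quotient stalks**: for `X` locally Noetherian,
`V(C)` is a regular scheme iff `𝒪_{X,x} / C_x` is a regular local ring for every `x ∈ V(C)`
(with `isRegularLocalRing_stalk_quotient_stalkIdeal` of `CanonicalResolutionSmoothCentre.lean`).
[folklore] -/
theorem Scheme.isRegular_subscheme_iff {X : Scheme.{u}} [IsLocallyNoetherian X]
    (C : X.IdealSheafData) :
    Scheme.IsRegular C.subscheme ↔
      ∀ x ∈ C.support, IsRegularLocalRing (X.presheaf.stalk x ⧸ stalkIdeal C x) :=
  ⟨fun h _ hx => isRegularLocalRing_stalk_quotient_stalkIdeal h hx,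
    Scheme.isRegular_subscheme_of_forall C⟩

end Literature.AlgebraicGeometry.Resolution

end
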